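import Summits.NavierStokesRegularity.NavierStokesRegularity.Theorems.AdaptedFrequencyAdaptedFrequencyConvergesStubDoeblinEvolve
import Summits.NavierStokesRegularity.NavierStokesRegularity.Theorems.AdaptedFrequencyAdaptedFrequencyConvergesStubDoeblinApprox

/-!
# Crux `AdaptedFrequencyConverges` (stmt-NavierStokesRegularity-10493), line
  `cloud-frame-effective-tsai`: the one-step Doeblin contraction for STUB `stub_doeblin`

Helper file (theorems only; lands `--supports stmt-NavierStokesRegularity-10493`) for the
registered stub `stub_doeblin` (uniqueness of the Gaussian-comparable adapted kernel, GIVEN Kato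
`L¹` monotonicity and the block solver). The heart of the Doeblin argument, `doeblin_oneStep`:
for two adapted kernels `K₁, K₂` of the same smooth divergence-free Type-I drift with a common
Gaussian upper bound `(C₁, C₂)`, on every dyadic block `[σ, σ']` (`T − σ = 2(T − σ') = 2ℓ`, room
`[s₀, σ' + ℓ/2] ⊆ S` below and above) and for every core radius `R > 0`,

  `∫ |K₁(σ) − K₂(σ)| ≤ (1 − η) ∫ |K₁(σ') − K₂(σ')| + 2 η τ(R)`,

with the BLOCK-INDEPENDENT overlap constant
`η = min 1 (kSubLow 3 (C/ν) (3R) ν · R³ · |B₁|) ∈ (0, 1]` and the uniform tail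
`τ(R) = C₁ (2πC₂)^{3/2} e^{−R²/(2C₂)}`. Proof: with `m' = ∫|D(σ')|`, `D = K₁ − K₂`, the parts
`(±D(σ'))⁺` have mass `m'/2` each and core mass `≥ m'/2 − τ(R)` (tightness); approximate them in
`L¹` within `θ` by smooth compactly supported nonnegative `P, N` (`doeblin_smooth_approx`) and
evolve (`doeblin_evolve`) into `W_P, W_N ≥ 0`. Kato in the limit on the signed solution
`D − W_P + W_N` gives `∫|D(σ) − W_P(σ) + W_N(σ)| ≤ 2θ`; Kato on `W_P`, `W_N` gives
`∫ W_P(σ) + ∫ W_N(σ) ≤ m' + 2θ`; the minorisation gives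
`min(W_P, W_N)(σ) ≥ (m'/2 − τ(R) − θ) η / |core|` on the core, whence
`∫|W_P(σ) − W_N(σ)| = ∫W_P + ∫W_N − 2∫min ≤ m' + 2θ − 2η(m'/2 − τ(R) − θ)` (`doeblin_overlap`);
`θ → 0`. The error carries the factor `η`, so the iteration over the blocks
(file `…StubDoeblin`) closes with `R → ∞` AFTER `n → ∞`.
-/

noncomputable section

namespace Summit.NavierStokesRegularity.NavierStokesRegularity.Theorems.AdaptedFrequencyConverges.CloudFrameEffectiveTsai

open scoped Topology Laplacian
open Literature.Analysis.FluidPDE Set Filter MeasureTheory Function Metric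

/-- **Overlap bound.** For integrable `u, w ≥ 0` bounded below by `c ≥ 0` on a set `s` of finite
measure: `∫ |u − w| ≤ ∫ u + ∫ w − 2 |s| c` (`|u − w| = u + w − 2 min(u, w)` and
`∫ min(u, w) ≥ ∫_s min(u, w) ≥ |s| c`). -/
theorem doeblin_overlap {u w : EuclideanSpace ℝ (Fin 3) → ℝ} (hui : Integrable u)
    (hwi : Integrable w) (hu0 : ∀ x, 0 ≤ u x) (hw0 : ∀ x, 0 ≤ w x)
    {s : Set (EuclideanSpace ℝ (Fin 3))} (hs : MeasurableSet s) (hsf : volume s ≠ ⊤) {c : ℝ}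
    (hcu : ∀ x ∈ s, c ≤ u x) (hcw : ∀ x ∈ s, c ≤ w x) :
    ∫ x, |u x - w x| ≤ (∫ x, u x) + (∫ x, w x) - 2 * (volume.real s * c) := by
  have hmi : Integrable (fun x => min (u x) (w x)) := hui.inf hwi
  have h1 : ∫ x in s, min (u x) (w x) ≤ ∫ x, min (u x) (w x) :=
    setIntegral_le_integral hmi (ae_of_all _ fun x => le_min (hu0 x) (hw0 x))
  have h2 : ∫ _ in s, c ≤ ∫ x in s, min (u x) (w x) :=
    setIntegral_mono_on (integrableOn_const hsf) hmi.integrableOn hs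
      fun x hx => le_min (hcu x hx) (hcw x hx)
  have h3 : ∫ _ in s, c = volume.real s * c := by rw [setIntegral_const, smul_eq_mul]
  have h4 : ∫ x, |u x - w x| = ∫ x, (u x + w x - 2 * min (u x) (w x)) :=
    integral_congr_ae (ae_of_all _ fun x => doeblin_abs_sub_eq (u x) (w x))
  have h5 : ∫ x, (u x + w x - 2 * min (u x) (w x)) =
      (∫ x, u x) + (∫ x, w x) - 2 * ∫ x, min (u x) (w x) := by
    have hadd : Integrable (fun x => u x + w x) := hui.add hwi
    rw [integral_sub hadd (hmi.const_mul 2), integral_add hui hwi, integral_const_mul]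
  rw [h4, h5]
  linarith

/-- Sign bookkeeping for the overlap: for `v, k ≥ 0` with `v k = η'`, `0 ≤ η ≤ η'` and `X ≤ μ`,
`η X ≤ v · max (μ k, 0)` (if `μ ≥ 0` then `v μ k = η' μ ≥ η μ ≥ η X`; if `μ < 0` then `X < 0` and
the right-hand side is nonnegative). -/
theorem doeblin_sign_bookkeeping {v k η η' X μ : ℝ} (hv : 0 ≤ v) (hk : 0 ≤ k) (hη0 : 0 ≤ η)
    (hηη' : η ≤ η') (hvk : v * k = η') (hXμ : X ≤ μ) : η * X ≤ v * max (μ * k) 0 := by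
  rcases le_or_gt 0 μ with hμ | hμ
  · have h1 : v * max (μ * k) 0 = μ * η' := by
      rw [max_eq_left (mul_nonneg hμ hk), ← hvk]; ring
    rw [h1]
    calc η * X ≤ η * μ := mul_le_mul_of_nonneg_left hXμ hη0
      _ ≤ η' * μ := mul_le_mul_of_nonneg_right hηη' hμ
      _ = μ * η' := mul_comm _ _
  · have hX : X < 0 := lt_of_le_of_lt hXμ hμ
    calc η * X ≤ 0 := mul_nonpos_of_nonneg_of_nonpos hη0 hX.le
      _ ≤ v * max (μ * k) 0 := mul_nonneg hv (le_max_right _ _)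


/-- Pointwise: `|d| ≤ |d − w + w'| + |w − w'|`. -/
theorem doeblin_abs_triangle (d w w' : ℝ) : |d| ≤ |d - w + w'| + |w - w'| := by
  have h := abs_add_le (d - w + w') (w - w')
  rwa [show d - w + w' + (w - w') = d by ring] at h

/-- Pointwise: if `p − n = d` then `|d − P + N| ≤ |P − p| + |N − n|`. -/
theorem doeblin_abs_data {d p n P N : ℝ} (h : p - n = d) : |d - P + N| ≤ |P - p| + |N - n| := by
  have h1 : d - P + N = -(P - p) + (N - n) := by rw [← h]; ring
  rw [h1]
  exact (abs_add_le _ _).trans (by rw [abs_neg])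

/-- **The one-step Doeblin contraction.** See the file header: for two adapted kernels `K₁, K₂`
on `S ⊆ (−∞, T)` of a smooth divergence-free Type-I drift `‖b‖ ≤ C/√(T − t)` with a common
Gaussian upper bound `(C₁, C₂)`, a dyadic block `[σ, σ']` (`T − σ = 2(T − σ')`, `σ' < T`) with
room `[s₀, σ' + (T − σ')/2] ⊆ S`, `s₀ < σ`, and a core radius `R > 0`:
`∫|K₁(σ) − K₂(σ)| ≤ (1 − η) ∫|K₁(σ') − K₂(σ')| + 2ητ(R)` with
`η = min 1 (kSubLow 3 (C/ν) (3R) ν · R³ · |B(0,1)|)` and `τ(R) = C₁ (2πC₂)^{3/2} e^{−R²/(2C₂)}`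
(given the Kato and block-solver hypotheses of `stub_doeblin`). -/
theorem doeblin_oneStep
    (hKato : ∀ (ν B s s' A a : ℝ)
      (b : ℝ → EuclideanSpace ℝ (Fin 3) → EuclideanSpace ℝ (Fin 3))
      (W : ℝ → EuclideanSpace ℝ (Fin 3) → ℝ), 0 < ν → s < s' → 0 < a →
      IsSmoothSpaceTimeOn (Icc s s') b → (∀ τ ∈ Icc s s', VectorCalculus.IsDivFree (b τ)) →
      (∀ τ ∈ Icc s s', ∀ x, ‖b τ x‖ ≤ B) → ContDiffOn ℝ 2 (uncurry W) (Icc s s' ×ˢ univ) →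
      (∀ τ ∈ Icc s s', ∀ x, timeDerivWithin (Icc s s') W τ x + fderiv ℝ (W τ) x (b τ x) +
        ν * Laplacian.laplacian (W τ) x = 0) →
      (∀ τ ∈ Icc s s', ∀ x, |W τ x| ≤ A * Real.exp (-‖x‖ ^ 2 / a)) →
      ∫ x, |W s x| ≤ ∫ x, |W s' x|)
    (hBlock : ∀ (ν B s₀ s s' s₁ : ℝ)
      (b : ℝ → EuclideanSpace ℝ (Fin 3) → EuclideanSpace ℝ (Fin 3))
      (f : EuclideanSpace ℝ (Fin 3) → ℝ), 0 < ν → 0 ≤ B → s₀ < s → s < s' → s' < s₁ →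
      IsSmoothSpaceTimeOn (Icc s₀ s₁) b → (∀ τ ∈ Icc s₀ s₁, VectorCalculus.IsDivFree (b τ)) →
      (∀ τ ∈ Icc s₀ s₁, ∀ x, ‖b τ x‖ ≤ B) → ContDiff ℝ (⊤ : ℕ∞) f → HasCompactSupport f →
      (∀ x, 0 ≤ f x) → ∃ W : ℝ → EuclideanSpace ℝ (Fin 3) → ℝ,
        ContDiffOn ℝ 2 (uncurry W) (Ico s s' ×ˢ univ) ∧
        (∀ τ ∈ Ico s s', ∀ x, timeDerivWithin (Ico s s') W τ x + fderiv ℝ (W τ) x (b τ x) +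
          ν * Laplacian.laplacian (W τ) x = 0) ∧
        (∀ τ ∈ Ico s s', ∀ x, 0 ≤ W τ x) ∧
        (∃ A a : ℝ, 0 < a ∧ ∀ τ ∈ Ico s s', ∀ x, W τ x ≤ A * Real.exp (-‖x‖ ^ 2 / a)) ∧
        (∀ ε : ℝ, 0 < ε → ∃ s₂ ∈ Ico s s', ∀ τ ∈ Ico s₂ s', ∀ x, |W τ x - f x| ≤ ε))
    {ν C T : ℝ} {S : Set ℝ} {b : ℝ → EuclideanSpace ℝ (Fin 3) → EuclideanSpace ℝ (Fin 3)}
    {x₀ : EuclideanSpace ℝ (Fin 3)} {K₁ K₂ : ℝ → EuclideanSpace ℝ (Fin 3) → ℝ} (hν : 0 < ν)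
    (hST : S ⊆ Iio T) (hb : IsSmoothSpaceTimeOn S b)
    (hdiv : ∀ t ∈ S, VectorCalculus.IsDivFree (b t))
    (hbd : ∀ t ∈ S, ∀ x, ‖b t x‖ ≤ C / Real.sqrt (T - t))
    (hK₁ : IsAdaptedBackwardKernel ν b S T x₀ K₁) (hK₂ : IsAdaptedBackwardKernel ν b S T x₀ K₂)
    {C₁ C₂ : ℝ} (hC₁ : 0 ≤ C₁) (hC₂ : 0 < C₂)
    (hup₁ : ∀ t ∈ S, ∀ x,
      K₁ t x ≤ C₁ * (T - t) ^ (-(3:ℝ) / 2) * Real.exp (-(‖x - x₀‖ ^ 2) / (C₂ * (T - t))))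
    (hup₂ : ∀ t ∈ S, ∀ x,
      K₂ t x ≤ C₁ * (T - t) ^ (-(3:ℝ) / 2) * Real.exp (-(‖x - x₀‖ ^ 2) / (C₂ * (T - t))))
    {R : ℝ} (hR : 0 < R) {s₀ σ σ' : ℝ} (hs₀ : s₀ < σ) (hσσ' : σ < σ') (hσ'T : σ' < T)
    (hℓ : T - σ = 2 * (T - σ')) (hI : Icc s₀ (σ' + (T - σ') / 2) ⊆ S) :
    ∫ x, |K₁ σ x - K₂ σ x| ≤
      (1 - min 1 (kSubLow 3 (C / ν) (3 * R) ν * R ^ 3 *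
          volume.real (ball (0 : EuclideanSpace ℝ (Fin 3)) 1))) * (∫ x, |K₁ σ' x - K₂ σ' x|) +
        2 * min 1 (kSubLow 3 (C / ν) (3 * R) ν * R ^ 3 *
          volume.real (ball (0 : EuclideanSpace ℝ (Fin 3)) 1)) *
          (C₁ * (2 * Real.pi * C₂) ^ ((3:ℝ) / 2) * Real.exp (-R ^ 2 / (2 * C₂))) := by
  -- abbreviations
  set v₁ : ℝ := volume.real (ball (0 : EuclideanSpace ℝ (Fin 3)) 1) with hv₁
  set κ : ℝ := kSubLow 3 (C / ν) (3 * R) ν with hκ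
  set η' : ℝ := κ * R ^ 3 * v₁ with hη'
  set η : ℝ := min 1 η' with hη
  set τR : ℝ := C₁ * (2 * Real.pi * C₂) ^ ((3:ℝ) / 2) * Real.exp (-R ^ 2 / (2 * C₂)) with hτR
  obtain ⟨m', hm'⟩ : ∃ m' : ℝ, m' = ∫ x, |K₁ σ' x - K₂ σ' x| := ⟨_, rfl⟩
  have hℓ0 : 0 < T - σ' := sub_pos.2 hσ'T
  have hκ0 : 0 < κ := kSubLow_pos _ _ _ hν
  have hη'0 : 0 < η' := mul_pos (mul_pos hκ0 (pow_pos hR 3)) doeblin_volume_unitBall_pos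
  have hη0 : 0 < η := lt_min one_pos hη'0
  have hη1 : η ≤ 1 := min_le_left _ _
  have hηη' : η ≤ η' := min_le_right _ _
  have hσ's₁ : σ' ≤ σ' + (T - σ') / 2 := by linarith
  have hIσ : Icc σ σ' ⊆ S := fun t ht => hI ⟨hs₀.le.trans ht.1, ht.2.trans hσ's₁⟩
  have hIco : Ico σ σ' ⊆ S := Ico_subset_Icc_self.trans hIσ
  have hσ'S : σ' ∈ S := hIσ (right_mem_Icc.2 hσσ'.le)
  have hσS : σ ∈ S := hIσ (left_mem_Icc.2 hσσ'.le)
  have hU : UniqueDiffOn ℝ (Ico σ σ') := uniqueDiffOn_Ico σ σ'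
  -- the slices at `σ'` and their positive / negative parts
  have hc₁ : Continuous (K₁ σ') := (hK₁.contDiff_slice hσ'S).continuous
  have hc₂ : Continuous (K₂ σ') := (hK₂.contDiff_slice hσ'S).continuous
  have hi₁ : Integrable (K₁ σ') := hK₁.integrable hσ'S
  have hi₂ : Integrable (K₂ σ') := hK₂.integrable hσ'S
  have h0₁ : ∀ x, 0 ≤ K₁ σ' x := fun x => (hK₁.pos σ' hσ'S x).le
  have h0₂ : ∀ x, 0 ≤ K₂ σ' x := fun x => (hK₂.pos σ' hσ'S x).le
  have hm₁₂ : ∫ x, K₁ σ' x = ∫ x, K₂ σ' x := by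
    rw [hK₁.integral_eq_one _ hσ'S, hK₂.integral_eq_one _ hσ'S]
  obtain ⟨_, hp0, hpK, hpi, hpm⟩ := doeblin_posPart hc₁ hc₂ hi₁ hi₂ h0₁ h0₂ hm₁₂
  obtain ⟨_, hn0, hnK, hni, hnm⟩ := doeblin_posPart hc₂ hc₁ hi₂ hi₁ h0₂ h0₁ hm₁₂.symm
  have hnm' : ∫ x, max (K₂ σ' x - K₁ σ' x) 0 = m' / 2 := by
    rw [hnm, hm']
    congr 1
    exact integral_congr_ae (ae_of_all _ fun x => abs_sub_comm _ _)
  rw [← hm'] at hpm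
  -- tightness: core masses of the parts
  have htail₁ := doeblin_tail_le hC₁ hC₂ hℓ0 hR.le hi₁ (fun x => hup₁ σ' hσ'S x)
  have htail₂ := doeblin_tail_le hC₁ hC₂ hℓ0 hR.le hi₂ (fun x => hup₂ σ' hσ'S x)
  rw [← hτR] at htail₁ htail₂
  have hcore_p : m' / 2 - τR ≤
      ∫ x in closedBall x₀ (R * Real.sqrt (T - σ')), max (K₁ σ' x - K₂ σ' x) 0 := by
    have hsplit := integral_add_compl (μ := volume)
      (measurableSet_closedBall (x := x₀) (ε := R * Real.sqrt (T - σ'))) hpi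
    have h2 : ∫ x in (closedBall x₀ (R * Real.sqrt (T - σ')))ᶜ, max (K₁ σ' x - K₂ σ' x) 0 ≤
        ∫ x in (closedBall x₀ (R * Real.sqrt (T - σ')))ᶜ, K₁ σ' x :=
      setIntegral_mono_on hpi.integrableOn hi₁.integrableOn measurableSet_closedBall.compl
        fun x _ => hpK x
    linarith
  have hcore_n : m' / 2 - τR ≤
      ∫ x in closedBall x₀ (R * Real.sqrt (T - σ')), max (K₂ σ' x - K₁ σ' x) 0 := by
    have hsplit := integral_add_compl (μ := volume)
      (measurableSet_closedBall (x := x₀) (ε := R * Real.sqrt (T - σ'))) hni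
    have h2 : ∫ x in (closedBall x₀ (R * Real.sqrt (T - σ')))ᶜ, max (K₂ σ' x - K₁ σ' x) 0 ≤
        ∫ x in (closedBall x₀ (R * Real.sqrt (T - σ')))ᶜ, K₂ σ' x :=
      setIntegral_mono_on hni.integrableOn hi₂.integrableOn measurableSet_closedBall.compl
        fun x _ => hnK x
    linarith
  -- volume bookkeeping: `κ ℓ^{-3/2} |core| = η'`
  have hvk : volume.real (closedBall x₀ (R * Real.sqrt (T - σ'))) *
      (κ * (T - σ') ^ (-(3:ℝ) / 2)) = η' := by
    rw [doeblin_volume_core x₀ hR.le hℓ0, hη']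
    have e : (T - σ') ^ ((3:ℝ) / 2) * (T - σ') ^ (-(3:ℝ) / 2) = 1 := by
      rw [← Real.rpow_add hℓ0]; norm_num
    calc R ^ 3 * (T - σ') ^ ((3:ℝ) / 2) * v₁ * (κ * (T - σ') ^ (-(3:ℝ) / 2))
        = κ * R ^ 3 * v₁ * ((T - σ') ^ ((3:ℝ) / 2) * (T - σ') ^ (-(3:ℝ) / 2)) := by ring
      _ = κ * R ^ 3 * v₁ := by rw [e, mul_one]
  have hkℓ0 : 0 ≤ κ * (T - σ') ^ (-(3:ℝ) / 2) :=
    mul_nonneg hκ0.le (Real.rpow_nonneg hℓ0.le _)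
  -- the estimate for every `θ > 0`
  have key : ∀ θ : ℝ, 0 < θ →
      ∫ x, |K₁ σ x - K₂ σ x| ≤ (1 - η) * m' + 2 * η * τR + 8 * θ := by
    intro θ hθ
    -- smooth data and their evolutions
    obtain ⟨P, hPs, hPcs, hP0, -, hPi, hPd⟩ := doeblin_smooth_approx hpi hp0 hθ
    obtain ⟨N, hNs, hNcs, hN0, -, hNi, hNd⟩ := doeblin_smooth_approx hni hn0 hθ
    obtain ⟨WP, hWPc, hWPe, hWP0, hWPenv, hWPlim, hWPi, hWPmass, hWPcore⟩ :=
      doeblin_evolve (x₀ := x₀) hKato hBlock hν hST hb hdiv hbd hR hs₀ hσσ' hσ'T hℓ hI hPs hPcs hP0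
    obtain ⟨WN, hWNc, hWNe, hWN0, hWNenv, hWNlim, hWNi, hWNmass, hWNcore⟩ :=
      doeblin_evolve (x₀ := x₀) hKato hBlock hν hST hb hdiv hbd hR hs₀ hσσ' hσ'T hℓ hI hNs hNcs hN0
    -- the signed solution `K₁ − K₂ − W_P + W_N`
    have hK₁r := doeblin_adj_mono hIco hU hK₁.contDiffOn hK₁.adjoint_eq
    have hK₂r := doeblin_adj_mono hIco hU hK₂.contDiffOn hK₂.adjoint_eq
    have hD := doeblin_adj_sub hU hK₁r.1 hK₁r.2 hK₂r.1 hK₂r.2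
    have hDW := doeblin_adj_sub hU hD.1 hD.2 hWPc hWPe
    have hE := doeblin_adj_add hU hDW.1 hDW.2 hWNc hWNe
    have henvK₁ := doeblin_envelope_mono Ico_subset_Icc_self
      (doeblin_kernel_envelope hC₁ hC₂ hσσ'.le hσ'T hIσ (fun t ht x => (hK₁.pos t ht x).le) hup₁)
    have henvK₂ := doeblin_envelope_mono Ico_subset_Icc_self
      (doeblin_kernel_envelope hC₁ hC₂ hσσ'.le hσ'T hIσ (fun t ht x => (hK₂.pos t ht x).le) hup₂)
    have henvE := doeblin_envelope_add (doeblin_envelope_sub (doeblin_envelope_sub henvK₁ henvK₂)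
      hWPenv) hWNenv
    have hlimE : ∀ x, Tendsto (fun τ => K₁ τ x - K₂ τ x - WP τ x + WN τ x) (𝓝[<] σ')
        (𝓝 (K₁ σ' x - K₂ σ' x - P x + N x)) := fun x =>
      (((doeblin_tendsto_kernel hK₁.contDiffOn hσσ' hIσ x).sub
        (doeblin_tendsto_kernel hK₂.contDiffOn hσσ' hIσ x)).sub (hWPlim x)).add (hWNlim x)
    have hA := doeblin_kato_limit hKato hν hST hb hdiv hbd hσσ' hIco hE.1 hE.2 henvE hlimE
    -- its terminal value is `2θ`-small in `L¹`
    have hgi : Integrable fun x => K₁ σ' x - K₂ σ' x - P x + N x := ((hi₁.sub hi₂).sub hPi).add hNi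
    have hg : ∫ x, |K₁ σ' x - K₂ σ' x - P x + N x| ≤ 2 * θ := by
      have hpt : ∀ x, |K₁ σ' x - K₂ σ' x - P x + N x| ≤
          |P x - max (K₁ σ' x - K₂ σ' x) 0| + |N x - max (K₂ σ' x - K₁ σ' x) 0| := by
        intro x
        refine doeblin_abs_data ?_
        have e := (doeblin_max_sub_max_neg (K₁ σ' x - K₂ σ' x)).1
        rwa [neg_sub] at e
      calc ∫ x, |K₁ σ' x - K₂ σ' x - P x + N x|
          ≤ ∫ x, (|P x - max (K₁ σ' x - K₂ σ' x) 0| + |N x - max (K₂ σ' x - K₁ σ' x) 0|) :=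
            integral_mono hgi.abs ((hPi.sub hpi).abs.add (hNi.sub hni).abs) hpt
        _ = (∫ x, |P x - max (K₁ σ' x - K₂ σ' x) 0|) +
              ∫ x, |N x - max (K₂ σ' x - K₁ σ' x) 0| :=
            integral_add (hPi.sub hpi).abs (hNi.sub hni).abs
        _ ≤ θ + θ := add_le_add hPd hNd
        _ = 2 * θ := by ring
    -- masses of the data
    have hPmass : ∫ x, P x ≤ m' / 2 + θ := by
      have h1 : ∫ x, (P x - max (K₁ σ' x - K₂ σ' x) 0) ≤ ∫ x, |P x - max (K₁ σ' x - K₂ σ' x) 0| :=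
        integral_mono (hPi.sub hpi) (hPi.sub hpi).abs fun x => le_abs_self _
      rw [integral_sub hPi hpi, hpm] at h1
      linarith
    have hNmass : ∫ x, N x ≤ m' / 2 + θ := by
      have h1 : ∫ x, (N x - max (K₂ σ' x - K₁ σ' x) 0) ≤ ∫ x, |N x - max (K₂ σ' x - K₁ σ' x) 0| :=
        integral_mono (hNi.sub hni) (hNi.sub hni).abs fun x => le_abs_self _
      rw [integral_sub hNi hni, hnm'] at h1
      linarith
    -- core masses of the data
    have hcoreP : m' / 2 - τR - θ ≤ ∫ x in closedBall x₀ (R * Real.sqrt (T - σ')), P x := by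
      have h1 : |∫ x in closedBall x₀ (R * Real.sqrt (T - σ')), (P x - max (K₁ σ' x - K₂ σ' x) 0)| ≤
          θ := by
        refine (abs_integral_le_integral_abs).trans ((setIntegral_le_integral (hPi.sub hpi).abs
          (ae_of_all _ fun x => abs_nonneg _)).trans hPd)
      have h2 : ∫ x in closedBall x₀ (R * Real.sqrt (T - σ')), (P x - max (K₁ σ' x - K₂ σ' x) 0) =
          (∫ x in closedBall x₀ (R * Real.sqrt (T - σ')), P x) -
            ∫ x in closedBall x₀ (R * Real.sqrt (T - σ')), max (K₁ σ' x - K₂ σ' x) 0 :=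
        integral_sub hPi.integrableOn hpi.integrableOn
      rw [h2, abs_le] at h1
      linarith [h1.1]
    have hcoreN : m' / 2 - τR - θ ≤ ∫ x in closedBall x₀ (R * Real.sqrt (T - σ')), N x := by
      have h1 : |∫ x in closedBall x₀ (R * Real.sqrt (T - σ')), (N x - max (K₂ σ' x - K₁ σ' x) 0)| ≤
          θ := by
        refine (abs_integral_le_integral_abs).trans ((setIntegral_le_integral (hNi.sub hni).abs
          (ae_of_all _ fun x => abs_nonneg _)).trans hNd)
      have h2 : ∫ x in closedBall x₀ (R * Real.sqrt (T - σ')), (N x - max (K₂ σ' x - K₁ σ' x) 0) =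
          (∫ x in closedBall x₀ (R * Real.sqrt (T - σ')), N x) -
            ∫ x in closedBall x₀ (R * Real.sqrt (T - σ')), max (K₂ σ' x - K₁ σ' x) 0 :=
        integral_sub hNi.integrableOn hni.integrableOn
      rw [h2, abs_le] at h1
      linarith [h1.1]
    -- the overlap at time `σ`
    set μ : ℝ := min (∫ x in closedBall x₀ (R * Real.sqrt (T - σ')), P x)
      (∫ x in closedBall x₀ (R * Real.sqrt (T - σ')), N x) with hμ
    have hXμ : m' / 2 - τR - θ ≤ μ := le_min hcoreP hcoreN
    have hcu : ∀ x ∈ closedBall x₀ (R * Real.sqrt (T - σ')),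
        max (μ * (κ * (T - σ') ^ (-(3:ℝ) / 2))) 0 ≤ WP σ x := fun x hx =>
      max_le ((mul_le_mul_of_nonneg_right (min_le_left _ _) hkℓ0).trans (hWPcore x hx))
        (hWP0 σ ⟨le_rfl, hσσ'⟩ x)
    have hcw : ∀ x ∈ closedBall x₀ (R * Real.sqrt (T - σ')),
        max (μ * (κ * (T - σ') ^ (-(3:ℝ) / 2))) 0 ≤ WN σ x := fun x hx =>
      max_le ((mul_le_mul_of_nonneg_right (min_le_right _ _) hkℓ0).trans (hWNcore x hx))
        (hWN0 σ ⟨le_rfl, hσσ'⟩ x)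
    have hover := doeblin_overlap hWPi hWNi (hWP0 σ ⟨le_rfl, hσσ'⟩) (hWN0 σ ⟨le_rfl, hσσ'⟩)
      measurableSet_closedBall measure_closedBall_lt_top.ne hcu hcw
    have hsign := doeblin_sign_bookkeeping (measureReal_nonneg) hkℓ0 hη0.le hηη' hvk hXμ
    -- triangle inequality at time `σ`
    have hDi : Integrable fun x => K₁ σ x - K₂ σ x := (hK₁.integrable hσS).sub (hK₂.integrable hσS)
    have hEi : Integrable fun x => K₁ σ x - K₂ σ x - WP σ x + WN σ x := (hDi.sub hWPi).add hWNi
    have htri : ∫ x, |K₁ σ x - K₂ σ x| ≤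
        (∫ x, |K₁ σ x - K₂ σ x - WP σ x + WN σ x|) + ∫ x, |WP σ x - WN σ x| := by
      calc ∫ x, |K₁ σ x - K₂ σ x|
          ≤ ∫ x, (|K₁ σ x - K₂ σ x - WP σ x + WN σ x| + |WP σ x - WN σ x|) :=
            integral_mono hDi.abs (hEi.abs.add (hWPi.sub hWNi).abs)
              fun x => doeblin_abs_triangle _ _ _
        _ = _ := integral_add hEi.abs (hWPi.sub hWNi).abs
    -- assembly
    have hfin : ∫ x, |K₁ σ x - K₂ σ x| ≤
        2 * θ + ((m' / 2 + θ) + (m' / 2 + θ) - 2 * (η * (m' / 2 - τR - θ))) := by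
      linarith [htri, hA, hg, hover, hsign, hWPmass, hWNmass, hPmass, hNmass]
    have hηθ : η * θ ≤ θ := mul_le_of_le_one_left hθ.le hη1
    linarith [hfin, hηθ]
  -- `θ → 0`
  rw [← hm']
  refine le_of_forall_pos_le_add fun ε hε => ?_
  have := key (ε / 8) (by positivity)
  linarith


/-! ### Registered sub-goal -/

/-- **Registered sub-goal `stub_doeblin_oneStep`** (the explicit form of `doeblin_oneStep`, the
one-step Doeblin contraction): `∫|K₁(σ) − K₂(σ)| ≤ (1 − η) ∫|K₁(σ') − K₂(σ')| + 2ητ(R)` on every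
dyadic block, with block-independent `η ∈ (0, 1]` and the uniform Gaussian tail `τ(R)`. -/
theorem stub_doeblin_oneStep :
    (∀ (ν B s s' A a : ℝ) (b : ℝ → (EuclideanSpace ℝ (Fin 3)) → (EuclideanSpace ℝ (Fin 3))) (W : ℝ → (EuclideanSpace ℝ (Fin 3)) → ℝ), 0 < ν → s < s' → 0 < a → IsSmoothSpaceTimeOn (Icc s s') b → (∀ τ ∈ Icc s s', VectorCalculus.IsDivFree (b τ)) → (∀ τ ∈ Icc s s', ∀ x, ‖b τ x‖ ≤ B) → ContDiffOn ℝ 2 (uncurry W) (Icc s s' ×ˢ univ) → (∀ τ ∈ Icc s s', ∀ x, timeDerivWithin (Icc s s') W τ x + fderiv ℝ (W τ) x (b τ x) + ν * Laplacian.laplacian (W τ) x = 0) → (∀ τ ∈ Icc s s', ∀ x, |W τ x| ≤ A * Real.exp (-‖x‖ ^ 2 / a)) → ∫ x, |W s x| ≤ ∫ x, |W s' x|) → (∀ (ν B s₀ s s' s₁ : ℝ) (b : ℝ → (EuclideanSpace ℝ (Fin 3)) → (EuclideanSpace ℝ (Fin 3))) (f : (EuclideanSpace ℝ (Fin 3))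 → ℝ), 0 < ν → 0 ≤ B → s₀ < s → s < s' → s' < s₁ → IsSmoothSpaceTimeOn (Icc s₀ s₁) b → (∀ τ ∈ Icc s₀ s₁, VectorCalculus.IsDivFree (b τ)) → (∀ τ ∈ Icc s₀ s₁, ∀ x, ‖b τ x‖ ≤ B) → ContDiff ℝ (⊤ : ℕ∞) f → HasCompactSupport f → (∀ x, 0 ≤ f x) → ∃ W : ℝ → (EuclideanSpace ℝ (Fin 3)) → ℝ, ContDiffOn ℝ 2 (uncurry W) (Ico s s' ×ˢ univ) ∧ (∀ τ ∈ Ico s s', ∀ x, timeDerivWithin (Ico s s') W τ x + fderiv ℝ (W τ) x (b τ x) + ν * Laplacian.laplacian (W τ) x = 0) ∧ (∀ τ ∈ Ico s s', ∀ x, 0 ≤ W τ x) ∧ (∃ A a : ℝ, 0 < a ∧ ∀ τ ∈ Ico s s', ∀ x, W τ x ≤ A * Real.exp (-‖x‖ ^ 2 / a)) ∧ (∀ ε : ℝ, 0 < ε → ∃ s₂ ∈ Ico s s', ∀ τ ∈ Ico s₂ s', ∀ x, |W τ x - f x| ≤ ε)) → ∀ (ν C T : ℝ) (S : Set ℝ)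 (b : ℝ → (EuclideanSpace ℝ (Fin 3)) → (EuclideanSpace ℝ (Fin 3))) (x₀ : (EuclideanSpace ℝ (Fin 3))) (K₁ K₂ : ℝ → (EuclideanSpace ℝ (Fin 3)) → ℝ) (C₁ C₂ R s₀ σ σ' : ℝ), 0 < ν → S ⊆ Iio T → IsSmoothSpaceTimeOn S b → (∀ t ∈ S, VectorCalculus.IsDivFree (b t)) → (∀ t ∈ S, ∀ x, ‖b t x‖ ≤ C / Real.sqrt (T - t)) → IsAdaptedBackwardKernel ν b S T x₀ K₁ → IsAdaptedBackwardKernel ν b S T x₀ K₂ → 0 ≤ C₁ → 0 < C₂ → (∀ t ∈ S, ∀ x, K₁ t x ≤ C₁ * (T - t) ^ (-(3:ℝ) / 2) * Real.exp (-(‖x - x₀‖ ^ 2) / (C₂ * (T - t)))) → (∀ t ∈ S, ∀ x, K₂ t x ≤ C₁ * (T - t) ^ (-(3:ℝ) / 2) * Real.exp (-(‖x - x₀‖ ^ 2) / (C₂ * (T - t)))) → 0 < R → s₀ < σ → σ < σ' → σ' < T → T - σ = 2 * (T - σ') → Icc s₀ (σ' + (T - σ') / 2) ⊆ S → ∫ x,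 |K₁ σ x - K₂ σ x| ≤ (1 - min 1 (kSubLow 3 (C / ν) (3 * R) ν * R ^ 3 * MeasureTheory.volume.real (Metric.ball (0 : EuclideanSpace ℝ (Fin 3)) 1))) * (∫ x, |K₁ σ' x - K₂ σ' x|) + 2 * min 1 (kSubLow 3 (C / ν) (3 * R) ν * R ^ 3 * MeasureTheory.volume.real (Metric.ball (0 : EuclideanSpace ℝ (Fin 3)) 1)) * (C₁ * (2 * Real.pi * C₂) ^ ((3:ℝ) / 2) * Real.exp (-R ^ 2 / (2 * C₂))) :=
  fun hKato hBlock _ _ _ _ _ _ _ _ _ _ _ _ _ _ hν hST hb hdiv hbd hK₁ hK₂ hC₁ hC₂ hup₁ hup₂ hR hs₀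
      hσσ' hσ'T hℓ hI =>
    doeblin_oneStep hKato hBlock hν hST hb hdiv hbd hK₁ hK₂ hC₁ hC₂ hup₁ hup₂ hR hs₀ hσσ' hσ'T hℓ hI

end Summit.NavierStokesRegularity.NavierStokesRegularity.Theorems.AdaptedFrequencyConverges.CloudFrameEffectiveTsai

end
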